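import Summits.QuantumAdvantage.Statement
import Literature.Computability.Complexity.CircuitClasses
import Literature.Computability.Cryptography.Shor

/-!
# QuantumAdvantage / CircuitLB — assembly

Route `QuantumAdvantage/CircuitLB` (thesis X: `BQP ⊄ P/poly`). Two bookkeeping items:

* `stmt-QuantumAdvantage-0253` (rank-1 assembly): Adleman's theorem `BPP ⊆ P/poly` (named fact
  `Literature.Computability.Complexity.BPP_subset_PPoly`, taken as a hypothesis) and `BQP ⊄ P/poly` give the summit
  `QuantumAdvantage`. NB the summit is the EXISTENTIAL form `∃ L, L ∈ BQP ∧ L ∉ BPP`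
  (`Literature.QuantumAdvantage.BQPNotSubsetBPP`), so the proof is by contradiction (classical): if no
  such `L` exists then `BQP ⊆ BPP ⊆ P/poly`.
* `stmt-QuantumAdvantage-0256` (crux 4): Shor (`FACT ∈ BQP`, named fact `Literature.Computability.Cryptography.FACT_mem_BQP`)
  and the non-uniform factoring assumption `FACT ∉ P/poly` give `BQP ⊄ P/poly` — one line.
-/

namespace Literature.QuantumAdvantage

/-- Settles `stmt-QuantumAdvantage-0253` (route CircuitLB, assembly): `BPP ⊆ P/poly` and
`BQP ⊄ P/poly` imply `QuantumAdvantage` (`∃ L ∈ BQP, L ∉ BPP`): otherwise every BQP language is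
in BPP, hence in P/poly (Adleman 1978; Arora–Barak 2009, Thm. 7.14). [cite: Adleman1978] -/
theorem circuitLB_assembly :
    Literature.Computability.Complexity.BPP_subset_PPoly → ¬ (Literature.Computability.Cryptography.BQP ⊆ Literature.Computability.Complexity.PPoly) → QuantumAdvantage := by
  intro hBPP hX
  by_contra h
  exact hX fun L hL => hBPP (by_contra fun hL' => h ⟨L, hL, hL'⟩)

/-- Settles `stmt-QuantumAdvantage-0256` (route CircuitLB, crux 4): Shor's theorem `FACT ∈ BQP`
and the non-uniform factoring assumption `FACT ∉ P/poly` give `BQP ⊄ P/poly` (Shor 1997, §5).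
[cite: Shor1997, §5] -/
theorem not_BQP_subset_PPoly_of_FACT :
    Literature.Computability.Cryptography.FACT_mem_BQP → Literature.Computability.QuantumComplexity.FACT ∉ Literature.Computability.Complexity.PPoly → ¬ (Literature.Computability.Cryptography.BQP ⊆ Literature.Computability.Complexity.PPoly) :=
  fun h1 h2 hsub => h2 (hsub h1)

end Literature.QuantumAdvantage
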